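import Mathlib
import Summits.AtomisticToContinuum.HydrodynamicLimit.Theorems.ImplosionDichotomyDenseExcursionCavityNegExpVolterra
import Summits.AtomisticToContinuum.HydrodynamicLimit.Theorems.ImplosionDichotomyDenseExcursionCavityCentreFuchs

/-!
# The smooth branch of a first-kind singular `2 × 2` system with exponents `0` and `ν`, `Re ν ≤ −1`
# (crux `DenseExcursion`, line `sonic-cavity-renewal`, brick for stub `stub_cavityResolventCk`, theorem T6b)

Helper file (`--supports stmt-AtomisticToContinuum-12586`, line lead a2, stub-worker E1 for `stub_cavityResolventCk`).
Complex-exponent analogue of `fuchs_negInt_branch` (`…CavityCentreFuchs`, exponent `−m`): registered helper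
`fuchs_branch_of_re_le_neg_one`. For smooth `a₁₁, a₁₂, a₂₁, a₂₂ : ℝ → ℂ` with `a₁₁(0) = ν`, `Re ν ≤ −1`, there is
`δ > 0` such that for all smooth sources `b₁, b₂` and every `c₀ : ℂ` the system

  `R·u′ = a₁₁ u + a₁₂ c + b₁`,   `c′ = a₂₁ u + a₂₂ c + b₂`

has a solution `(u, c)` of class `C^∞` on `(−δ, δ)` with `c(0) = c₀`. Construction as at the centre: Hadamard
`a₁₁ − ν = R·α`, integrating factor `μ = exp ∫₀ᴿ α` conjugating the `u`-row to the Euler row `R·ũ′ = ν ũ + h`,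
`h = (a₁₂c + b₁)/μ`, solved by the complex-weight Euler operator `E_a h = ∫₀¹ t^a h(Rt) dt`, `a = −ν − 1` (`Re a ≥ 0`:
NO Taylor subtraction, no loss of derivatives, `…CavityNegExpEuler`); the `c`-row is a Volterra equation; the continuous
fixed point (`negexp_volterra_fixed_point`) is smooth by the bootstrap `c ∈ C^k ⇒ u ∈ C^k ⇒ c ∈ C^{k+1}`. This is the
local theory of the smooth branch of the cavity resolvent at the repulsive sonic point for the real spectral parameters
with `Re ν(Λ) ≤ −1`, including the apparent resonances `ν = −m` where the second analytic Frobenius branch fails to exist.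
Sources: folklore (Coddington–Levinson Ch. 4 §2).
-/

noncomputable section

open Set Filter MeasureTheory intervalIntegral
open scoped Topology ContDiff

namespace Summit.AtomisticToContinuum.HydrodynamicLimit.Theorems.SonicCavityRenewal

/-- **Registered helper `fuchs_branch_of_re_le_neg_one`: THE SMOOTH BRANCH OF A FIRST-KIND SINGULAR `2 × 2` SYSTEM WITH
EXPONENTS `0` AND `ν`, `Re ν ≤ −1`.** See the module docstring. [folklore] -/
theorem fuchs_branch_of_re_le_neg_one : ∀ (ν : ℂ) (a₁₁ a₁₂ a₂₁ a₂₂ : ℝ → ℂ), ν.re ≤ -1 → ContDiff ℝ ∞ a₁₁ → ContDiff ℝ ∞ a₁₂ → ContDiff ℝ ∞ a₂₁ → ContDiff ℝ ∞ a₂₂ → a₁₁ 0 = ν → ∃ δ : ℝ, 0 < δ ∧ ∀ (b₁ b₂ : ℝ → ℂ), ContDiff ℝ ∞ b₁ → ContDiff ℝ ∞ b₂ → ∀ c₀ : ℂ, ∃ u c : ℝ → ℂ, ContDiffOn ℝ ∞ u (Set.Ioo (-δ) δ) ∧ ContDiffOn ℝ ∞ c (Set.Ioo (-δ) δ) ∧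 c 0 = c₀ ∧ ∀ R ∈ Set.Ioo (-δ) δ, (R : ℂ) * deriv u R = a₁₁ R * u R + a₁₂ R * c R + b₁ R ∧ deriv c R = a₂₁ R * u R + a₂₂ R * c R + b₂ R := by
  intro ν a₁₁ a₁₂ a₂₁ a₂₂ hν ha₁₁ ha₁₂ ha₂₁ ha₂₂ h0
  -- the weight exponent
  set a : ℂ := -ν - 1 with ha_def
  have ha : 0 ≤ a.re := by simp only [ha_def, Complex.sub_re, Complex.neg_re, Complex.one_re]; linarith
  -- Hadamard: `a₁₁ − ν = R·α`
  obtain ⟨α, hα, hαeq, -⟩ := hadamard_quotient (φ := fun R => a₁₁ R - ν) (ha₁₁.sub contDiff_const) (by simp [h0])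
  -- the integrating factor `μ = exp ∫₀ᴿ α`
  obtain ⟨hPsm, hPd⟩ := contDiff_primitive hα
  set μ : ℝ → ℂ := fun R => Complex.exp (∫ s in (0 : ℝ)..R, α s) with hμ
  have hμsm : ContDiff ℝ ∞ μ := Complex.contDiff_exp.comp hPsm
  have hμ0 : ∀ R, μ R ≠ 0 := fun R => Complex.exp_ne_zero _
  have hμd : ∀ R, HasDerivAt μ (α R * μ R) R := fun R => by
    have := (hPd R).cexp
    simpa [hμ, mul_comm] using this
  -- the Volterra fixed point
  obtain ⟨δ, hδ, hfix⟩ := negexp_volterra_fixed_point a μ a₁₂ a₂₁ a₂₂ ha hμsm.continuous hμ0 ha₁₂.continuous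
    ha₂₁.continuous ha₂₂.continuous
  refine ⟨δ, hδ, fun b₁ b₂ hb₁ hb₂ c₀ => ?_⟩
  obtain ⟨u, c, hu_cont, hc_cont, hu, hc⟩ := hfix b₁ b₂ hb₁.continuous hb₂.continuous c₀
  have hU : IsOpen (Ioo (-δ) δ) := isOpen_Ioo
  -- the source of the Euler row and the integrand of the primitive
  set h : ℝ → ℂ := fun s => (a₁₂ s * c s + b₁ s) / μ s with hh
  set Y : ℝ → ℂ := fun R => ∫ t in (0 : ℝ)..1, (t : ℂ) ^ a * h (R * t) with hY
  set K : ℝ → ℂ := fun s => a₂₁ s * u s + a₂₂ s * c s + b₂ s with hK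
  have huY : u = fun R => μ R * Y R := funext fun R => by rw [hu R]
  have hKc : Continuous K := ((ha₂₁.continuous.mul hu_cont).add (ha₂₂.continuous.mul hc_cont)).add hb₂.continuous
  -- the derivative of `c` on `(−δ, δ)`
  have hcd : ∀ R ∈ Ioo (-δ) δ, HasDerivAt c (K R) R := by
    intro R hR
    have hprim : HasDerivAt (fun R => c₀ + ∫ s in (0 : ℝ)..R, K s) (K R) R := by
      have := integral_hasDerivAt_right (hKc.intervalIntegrable 0 R) hKc.aestronglyMeasurable.stronglyMeasurableAtFilter
        hKc.continuousAt
      simpa using this.const_add c₀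
    refine hprim.congr_of_eventuallyEq ?_
    filter_upwards [hU.mem_nhds hR] with s hs
    exact hc s (Ioo_subset_Icc_self hs)
  -- bootstrap
  have hle : ∀ {n : ℕ∞}, ((n : ℕ∞) : WithTop ℕ∞) ≤ ∞ := fun {n} => by exact_mod_cast le_top
  have hhdef : h = fun s => (a₁₂ s * c s + b₁ s) * (μ s)⁻¹ := funext fun s => div_eq_mul_inv _ _
  have hboot : ∀ k : ℕ, ContDiffOn ℝ k c (Ioo (-δ) δ) ∧ ContDiffOn ℝ k u (Ioo (-δ) δ) := by
    have step_u : ∀ {n : ℕ∞}, ContDiffOn ℝ n c (Ioo (-δ) δ) → ContDiffOn ℝ n u (Ioo (-δ) δ) := by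
      intro n hcn
      have hhn : ContDiffOn ℝ n h (Ioo (-δ) δ) := by
        rw [hhdef]
        exact (((ha₁₂.of_le hle).contDiffOn.mul hcn).add (hb₁.of_le hle).contDiffOn).mul
          ((hμsm.of_le hle).contDiffOn.inv fun s _ => hμ0 s)
      rw [huY]
      exact (hμsm.of_le hle).contDiffOn.mul (contDiffOn_eulerCpow_local ha hhn)
    intro k
    induction k with
    | zero =>
      have hc0 : ContDiffOn ℝ 0 c (Ioo (-δ) δ) := contDiffOn_zero.2 hc_cont.continuousOn
      exact ⟨by exact_mod_cast hc0, by exact_mod_cast step_u hc0⟩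
    | succ k ih =>
      obtain ⟨ihc, ihu⟩ := ih
      have hKk : ContDiffOn ℝ k K (Ioo (-δ) δ) :=
        ((((ha₂₁.of_le hle).contDiffOn.mul ihu).add ((ha₂₂.of_le hle).contDiffOn.mul ihc)).add
          (hb₂.of_le hle).contDiffOn)
      have hck : ContDiffOn ℝ ((k + 1 : ℕ) : WithTop ℕ∞) c (Ioo (-δ) δ) := by
        rw [Nat.cast_succ, contDiffOn_succ_iff_deriv_of_isOpen hU]
        refine ⟨fun R hR => (hcd R hR).differentiableAt.differentiableWithinAt,
          fun h => (WithTop.natCast_ne_top k h).elim, ?_⟩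
        exact hKk.congr fun R hR => (hcd R hR).deriv
      have hck' : ContDiffOn ℝ ((k + 1 : ℕ) : ℕ∞) c (Ioo (-δ) δ) := by exact_mod_cast hck
      exact ⟨by exact_mod_cast hck', by exact_mod_cast step_u hck'⟩
  have hcs : ContDiffOn ℝ ∞ c (Ioo (-δ) δ) := contDiffOn_infty.2 fun k => (hboot k).1
  have hus : ContDiffOn ℝ ∞ u (Ioo (-δ) δ) := contDiffOn_infty.2 fun k => (hboot k).2
  have hhs : ContDiffOn ℝ ∞ h (Ioo (-δ) δ) := by
    rw [hhdef]
    exact ((ha₁₂.contDiffOn.mul hcs).add hb₁.contDiffOn).mul (hμsm.contDiffOn.inv fun s _ => hμ0 s)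
  -- the Euler row
  obtain ⟨hYs, hYode, -⟩ := eulerCpow_local a δ h ha hδ hhs
  refine ⟨u, c, hus, hcs, by have := hc 0 ⟨by linarith, by linarith⟩; simpa using this, fun R hR => ⟨?_, (hcd R hR).deriv⟩⟩
  have hYd : HasDerivAt Y (deriv Y R) R :=
    ((hYs.differentiableOn (by simp)) R hR).differentiableAt (hU.mem_nhds hR) |>.hasDerivAt
  have hud : HasDerivAt u (α R * μ R * Y R + μ R * deriv Y R) R := by
    rw [huY]; exact (hμd R).mul hYd
  rw [hud.deriv]
  have e1 := hYode R hR
  have e1' : (R : ℂ) * deriv Y R = ν * Y R + h R := by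
    have : -(a + 1) = ν := by rw [ha_def]; ring
    rw [← this]; exact e1
  have e2 : (R : ℂ) * α R = a₁₁ R - ν := by simpa using (hαeq R).symm
  have e3 : μ R * h R = a₁₂ R * c R + b₁ R := by
    simp only [hh]; field_simp [hμ0 R]
  have e4 : u R = μ R * Y R := by rw [huY]
  rw [e4]
  linear_combination (μ R * Y R) * e2 + μ R * e1' + e3

end Summit.AtomisticToContinuum.HydrodynamicLimit.Theorems.SonicCavityRenewal

end
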